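import Summits.HubbardSuperconductivity.HubbardSuperconductivity.Theorems.NodalWardXYPerturbedXYOrderSmallVolume

/-!
# `PerturbedXYOrder` (stmt-HubbardSuperconductivity-10739) — line `schwarz-inheritance`: large-volume reduction

The open stub `stub_complexStability` of the line (uniform-in-`L` zero-freeness of the perturbed partition
function and boundedness of the complex plateau, for all tori `L ≥ 2`) is equivalent to the same statement
for all `L ≥ L₀`, for any `L₀`: the finitely many small tori are free at every coupling `J` by
`stub_smallVolumeStability` (`9 ε L⁶ ≤ 1 ⇒ Z_K ≠ 0 ∧ ‖cratio‖ ≤ 2`), after shrinking the radius to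
`min ε₂ (9 L₀⁶ + 1)⁻¹` and enlarging the bound to `max B 2`.  So the open content of the crux lives entirely
in the thermodynamic regime `L → ∞` (uniformity of `J₀` in `L`).
-/

noncomputable section

namespace Summit.HubbardSuperconductivity.HubbardSuperconductivity.Theorems.PerturbedXYOrder

open MeasureTheory Literature.Probability.LatticeModels
open Summit.HubbardSuperconductivity.HubbardSuperconductivity.Theses.NodalWardXY

variable {L : ℕ}

/-- Admissibility is monotone in the radius. -/
theorem lv_admissible_mono [NeZero L] {ε ε' : ℝ} (h : ε ≤ ε') {K : Bond L → Bond L → ℂ}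
    (hK : Admissible L ε K) : Admissible L ε' K := fun b b' =>
  (hK b b').trans (div_le_div_of_nonneg_right h (by positivity))

/-- **Large-volume reduction of complex stability.** The registered open stub `stub_complexStability`
(all tori `L ≥ 2`) is equivalent to its restriction to `L ≥ L₀`, for any `L₀ : ℕ`: small tori are free at
every `J` (`stub_smallVolumeStability`). -/
theorem complexStability_iff_largeVolume :
    (∃ J₀ ε₂ B : ℝ, 0 < ε₂ ∧ 0 < B ∧ ∀ J : ℝ, J₀ ≤ J → ∀ (L : ℕ) [NeZero L], 2 ≤ L →
        ∀ K : Bond L → Bond L → ℂ, Admissible L ε₂ K → Zk J K ≠ 0 ∧ ‖cratio L J K‖ ≤ B) ↔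
      ∃ L₀ : ℕ, ∃ J₀ ε₂ B : ℝ, 0 < ε₂ ∧ 0 < B ∧ ∀ J : ℝ, J₀ ≤ J → ∀ (L : ℕ) [NeZero L], L₀ ≤ L →
        ∀ K : Bond L → Bond L → ℂ, Admissible L ε₂ K → Zk J K ≠ 0 ∧ ‖cratio L J K‖ ≤ B := by
  constructor
  · rintro ⟨J₀, ε₂, B, hε₂, hB, h⟩
    exact ⟨2, J₀, ε₂, B, hε₂, hB, h⟩
  · rintro ⟨L₀, J₀, ε₂, B, hε₂, hB, h⟩
    set ε' : ℝ := min ε₂ (1 / (9 * (L₀ : ℝ) ^ 6 + 1)) with hε'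
    have hε'pos : 0 < ε' := lt_min hε₂ (by positivity)
    have hε'le : ε' ≤ ε₂ := min_le_left _ _
    refine ⟨J₀, ε', max B 2, hε'pos, lt_max_of_lt_left hB, fun J hJ L _ _hL K hK => ?_⟩
    by_cases hLL : L₀ ≤ L
    · obtain ⟨hZ, hc⟩ := h J hJ L hLL K (lv_admissible_mono hε'le hK)
      exact ⟨hZ, hc.trans (le_max_left _ _)⟩
    · -- small torus `L < L₀`: free at every `J`
      have hlt : L < L₀ := not_le.1 hLL
      have hLle : (L : ℝ) ≤ (L₀ : ℝ) := by exact_mod_cast hlt.le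
      have hL0 : (0 : ℝ) ≤ (L : ℝ) := Nat.cast_nonneg L
      have hsmall : 9 * ε' * (L : ℝ) ^ 6 ≤ 1 := by
        have h1 : ε' ≤ 1 / (9 * (L₀ : ℝ) ^ 6 + 1) := min_le_right _ _
        have h2 : (L : ℝ) ^ 6 ≤ (L₀ : ℝ) ^ 6 := pow_le_pow_left₀ hL0 hLle 6
        have h3 : (0 : ℝ) < 9 * (L₀ : ℝ) ^ 6 + 1 := by positivity
        calc 9 * ε' * (L : ℝ) ^ 6 ≤ 9 * (1 / (9 * (L₀ : ℝ) ^ 6 + 1)) * (L₀ : ℝ) ^ 6 := by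
              gcongr
          _ = 9 * (L₀ : ℝ) ^ 6 / (9 * (L₀ : ℝ) ^ 6 + 1) := by ring
          _ ≤ 1 := by rw [div_le_one h3]; linarith
      obtain ⟨hZ, hc⟩ := stub_smallVolumeStability L ε' hsmall J K hK
      exact ⟨hZ, hc.trans (le_max_right _ _)⟩

end Summit.HubbardSuperconductivity.HubbardSuperconductivity.Theorems.PerturbedXYOrder

end
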